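import Mathlib
import Literature.Probability.RandomPlanarGeometry.HexSAW
import Summits.CriticalPhenomena.SAWScalingLimit.Theses.SAWMassiveIsingTilt

/-!
# `CornerLaw` — the `y = 0` edge of the tilted interface family is the hexagonal SAW law

Route `SAWMassiveIsingTilt`, item stmt-CriticalPhenomena-9857 (support).

At loop fugacity `y = 0` the honeycomb loop-gas partition function
`Zloop(H, S; 0) = ∑ᶠ_{E even subgraph} 0 ^ |E|` keeps only the empty subgraph, so it equals `1`;
hence the tilted weight of a SAW `γ` is `x_c ^ ℓ(γ)` and the tilted law at
`(x, y) = (x_c(Hex), 0)` is `embLaw hexGraph hexCenter Ω δ x_c a b = hexSAWLaw Ω δ a b`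
on the nose (an equality of measures).
-/

namespace Summit.CriticalPhenomena.SAWScalingLimit.Theorems

open MeasureTheory
open Literature.Probability.LatticeModels Literature.Probability.RandomPlanarGeometry
  Literature.Probability.RandomPlanarGeometry.SAW

/-- At fugacity `0` a sum of `0 ^ |E|` over any family of finite edge sets containing `∅`
collapses to the `E = ∅` term: `∑ᶠ E ∈ s, 0 ^ |E| = 1`. [folklore] -/
theorem finsum_mem_zero_pow_card_eq_one {α : Type*} (s : Set (Finset α)) (hs : ∅ ∈ s) :
    ∑ᶠ E ∈ s, (0 : ℝ) ^ E.card = 1 := by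
  rw [finsum_mem_def, finsum_eq_single _ ∅]
  · rw [Set.indicator_of_mem hs, Finset.card_empty, pow_zero]
  · intro E hE
    rw [Set.indicator_apply_eq_zero]
    intro _
    exact zero_pow (Finset.card_ne_zero.mpr (Finset.nonempty_iff_ne_empty.mpr hE))

/-- **CornerLaw** (item stmt-CriticalPhenomena-9857 of route `SAWMassiveIsingTilt`): for every
`Ω, δ, a, b` the tilted interface law at the SAW corner `(x, y) = (x_c(Hex), 0)` *is* the critical
hexagonal SAW law `hexSAWLaw Ω δ a b` — `Zloop(H, S; 0) = 1` (only `E = ∅` survives), so the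
tilted weight is `x_c ^ ℓ(γ)` and the normalised law is `embLaw` at `hexCriticalFugacity`,
definitionally. [cite: DuminilCopinSmirnov2012, §4 (before Conjecture 1)] -/
theorem cornerLaw_proof :
    Summit.CriticalPhenomena.SAWScalingLimit.Theses.SAWMassiveIsingTilt.CornerLaw := by
  unfold Summit.CriticalPhenomena.SAWScalingLimit.Theses.SAWMassiveIsingTilt.CornerLaw
  dsimp only
  intro Ω δ a b
  simp (disch := simp) only [finsum_mem_zero_pow_card_eq_one, mul_one]
  rfl

end Summit.CriticalPhenomena.SAWScalingLimit.Theorems
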